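import Literature.Analysis.FluidPDE.GaussianAnisotropicPoincare
import Literature.Analysis.FluidPDE.GaussianWeightedSpace
import Literature.Analysis.UnboundedOperators.WeightedGreenIdentity
import HarnessLib

/-!
# The spectral gap `(1−λ)/2` of `L_λ` in `L²(𝒢_λ⁻¹ dx)` for every asymmetry `λ ∈ [0,1)`

Analysis/FluidPDE file (all results proved, no definitions, no named facts): the linear estimate
behind the named fact `Literature.Analysis.FluidPDE.GallayMaekawa2016_thm41` (Gallay–Maekawa
2016, Thm. 4.1, existence of asymmetric Burgers vortices for all `λ ∈ [0,1)`), for the vendored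
operator `strainedVorticityOperator lam = L_λ = Δ + (1+λ)/2 x₀∂₀ + (1−λ)/2 x₁∂₁ + 1` (survey (4.3))
and the anisotropic Gaussian `𝒢_λ ∝ ρ_λ = exp(−(1+λ)x₀²/4 − (1−λ)x₁²/4)` (survey (4.4)):

* `strainedVorticityOperator_weight_mul` — **ground-state conjugation for general `λ`**: for a
  `C²` weight `ρ` with `∂₀ρ = −((1+λ)x₀/2)ρ`, `∂₁ρ = −((1−λ)x₁/2)ρ` (i.e. `ρ = k ρ_λ`) and `u ∈ C²`,
  `L_λ(ρu) = ρ (Δu − ((1+λ)/2 x₀∂₀u + (1−λ)/2 x₁∂₁u))` pointwise (`L_λ = ∇·(∇ + b_λ)`,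
  `b_λ = ((1+λ)x₀/2, (1−λ)x₁/2)`, is conjugate to the Ornstein–Uhlenbeck operator `Δ − b_λ·∇`;
  `λ = 0`: Gallay–Wayne 2005, (73), `GaussianVortexGroundState`);
* `integral_adjointLam_mul_mul_expNegQuadLam` — **Dirichlet form**:
  `∫ (Δu − b_λ·∇u) v ρ_λ = −∫ (∂₀u∂₀v + ∂₁u∂₁v) ρ_λ` (`u ∈ C²`, `v ∈ C¹`, bounded derivatives),
  from the weighted Green identity `integral_ornsteinUhlenbeck_mul_mul_weight`;
* `integral_strainedVorticityOperator_mul_div_expNegQuadLam_le` — **the spectral gap**: for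
  `w = ρ_λ u`, `u ∈ C²` with `u, Du, D²u` bounded and `∫ w = 0`,
  `∫ (L_λw) w/ρ_λ ≤ −(1−λ)/2 ∫ w²/ρ_λ`, from the anisotropic Gaussian Poincaré inequality
  (`integral_sq_mul_expNegQuadLam_le`); the gap `(1−λ)/2` closes as `λ → 1`, the linear reason
  for the hypothesis `λ < 1` in Theorem 4.1;
* `memL2InftyLam_of_integrable_sq_div_expNegQuadLam` — `L²(ρ_λ⁻¹dx) ⊆ L²(∞;λ)` (survey (4.6)).

## References

* Th. Gallay, Y. Maekawa, *Existence and stability of viscous vortices*, arXiv:1610.08384, §4.1,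
  (4.3)–(4.6), Thm. 4.1. [GallayMaekawa2016]
* Th. Gallay, C. E. Wayne, Comm. Math. Phys. 255 (2005), (73), App. A (`λ = 0`). [folklore] -/

open MeasureTheory Filter Set WithLp
open scoped Real RealInnerProductSpace Topology Laplacian

noncomputable section

namespace Literature.Analysis.FluidPDE

open Literature.Analysis.UnboundedOperators

/-! ### Ground-state conjugation of `L_λ` for a weight with `∇ρ = −b_λ ρ` -/

section Weight

variable {ρ u : EuclideanSpace ℝ (Fin 2) → ℝ} (hρ : ContDiff ℝ 2 ρ) (hu : ContDiff ℝ 2 u)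
include hρ hu

/-- `∂ᵢ(ρu) = ρ (∂ᵢu − (κ/2) xᵢ u)` for a weight with `∂ᵢρ = −(κxᵢ/2)ρ`. [folklore] -/
theorem fderiv_weight_mul_apply_single (i : Fin 2) {κ : ℝ}
    (hρi : ∀ x, fderiv ℝ ρ x (EuclideanSpace.single i (1 : ℝ)) = -(κ * x i / 2) * ρ x) :
    (fun y => fderiv ℝ (fun z => ρ z * u z) y (EuclideanSpace.single i (1 : ℝ))) =
      fun y => ρ y * (fderiv ℝ u y (EuclideanSpace.single i (1 : ℝ)) - κ / 2 * y i * u y) := by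
  funext y
  have hρd : HasFDerivAt ρ (fderiv ℝ ρ y) y := (hρ.differentiable two_ne_zero y).hasFDerivAt
  have hud : HasFDerivAt u (fderiv ℝ u y) y := (hu.differentiable two_ne_zero y).hasFDerivAt
  rw [(hρd.fun_mul hud).fderiv]
  simp only [add_apply, FunLike.coe_smul, Pi.smul_apply, smul_eq_mul, hρi]
  ring

/-- `∂ᵢ∂ᵢ(ρu) = ρ (∂ᵢ∂ᵢu − κxᵢ ∂ᵢu − (κ/2) u + (κxᵢ/2)² u)` for a weight with `∂ᵢρ = −(κxᵢ/2)ρ`.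
[folklore] -/
theorem fderiv_fderiv_weight_mul_apply_single (i : Fin 2) {κ : ℝ}
    (hρi : ∀ x, fderiv ℝ ρ x (EuclideanSpace.single i (1 : ℝ)) = -(κ * x i / 2) * ρ x)
    (x : EuclideanSpace ℝ (Fin 2)) :
    fderiv ℝ (fun y => fderiv ℝ (fun z => ρ z * u z) y (EuclideanSpace.single i (1 : ℝ))) x
        (EuclideanSpace.single i (1 : ℝ)) =
      ρ x * (fderiv ℝ (fun y => fderiv ℝ u y (EuclideanSpace.single i (1 : ℝ))) x
          (EuclideanSpace.single i (1 : ℝ)) -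
        κ * x i * fderiv ℝ u x (EuclideanSpace.single i (1 : ℝ)) - κ / 2 * u x +
        (κ * x i / 2) ^ 2 * u x) := by
  rw [fderiv_weight_mul_apply_single hρ hu i hρi]
  have hρd : HasFDerivAt ρ (fderiv ℝ ρ x) x := (hρ.differentiable two_ne_zero x).hasFDerivAt
  have hud : ∀ y, HasFDerivAt u (fderiv ℝ u y) y := fun y =>
    (hu.differentiable two_ne_zero y).hasFDerivAt
  have hu1 : ContDiff ℝ 1 (fun y => fderiv ℝ u y (EuclideanSpace.single i (1 : ℝ))) :=
    (hu.fderiv_right (m := 1) le_rfl).clm_apply contDiff_const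
  have hu1d : HasFDerivAt (fun y => fderiv ℝ u y (EuclideanSpace.single i (1 : ℝ)))
      (fderiv ℝ (fun y => fderiv ℝ u y (EuclideanSpace.single i (1 : ℝ))) x) x :=
    (hu1.differentiable one_ne_zero x).hasFDerivAt
  have hcoord : HasFDerivAt (fun y : EuclideanSpace ℝ (Fin 2) => y i)
      (EuclideanSpace.proj i : EuclideanSpace ℝ (Fin 2) →L[ℝ] ℝ) x :=
    (EuclideanSpace.proj i : EuclideanSpace ℝ (Fin 2) →L[ℝ] ℝ).hasFDerivAt
  have hψ : HasFDerivAt (fun y : EuclideanSpace ℝ (Fin 2) =>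
      fderiv ℝ u y (EuclideanSpace.single i (1 : ℝ)) - κ / 2 * y i * u y)
      (fderiv ℝ (fun y => fderiv ℝ u y (EuclideanSpace.single i (1 : ℝ))) x -
        ((κ / 2 * x i) • fderiv ℝ u x +
          u x • ((κ / 2) • (EuclideanSpace.proj i : EuclideanSpace ℝ (Fin 2) →L[ℝ] ℝ)))) x :=
    hu1d.sub ((hcoord.const_mul (κ / 2)).fun_mul (hud x))
  rw [(hρd.fun_mul hψ).fderiv]
  simp only [add_apply, sub_apply, FunLike.coe_smul, Pi.smul_apply,
    smul_eq_mul, hρi]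
  simp
  ring

/-- **Ground-state conjugation of `L_λ` for every asymmetry `λ`**: if the `C²` weight `ρ`
satisfies `∂₀ρ = −((1+λ)x₀/2)ρ` and `∂₁ρ = −((1−λ)x₁/2)ρ` (equivalently `ρ = k ρ_λ`,
`ρ_λ = exp(−(1+λ)x₀²/4 − (1−λ)x₁²/4)`, the profile of Gallay–Maekawa's `𝒢_λ`, (4.4)), then for
every `u ∈ C²(ℝ²)`,
`L_λ(ρu) = ρ · (Δu − ((1+λ)/2 x₀∂₀u + (1−λ)/2 x₁∂₁u))` pointwise, where
`L_λ = Δ + (1+λ)/2 x₀∂₀ + (1−λ)/2 x₁∂₁ + 1 = strainedVorticityOperator lam` (4.3). In divergence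
form `L_λ = ∇·(∇ + b_λ)`, `b_λ = ∇(−log ρ_λ)`, so `ρ_λ⁻¹ L_λ ρ_λ = Δ − b_λ·∇` is an
Ornstein–Uhlenbeck operator; `u = 1` recovers `L_λ 𝒢_λ = 0`. [cite: GallayMaekawa2016, (4.3)–(4.4)] -/
theorem strainedVorticityOperator_weight_mul (lam : ℝ)
    (hρ0 : ∀ x, fderiv ℝ ρ x (EuclideanSpace.single 0 (1 : ℝ)) = -((1 + lam) * x 0 / 2) * ρ x)
    (hρ1 : ∀ x, fderiv ℝ ρ x (EuclideanSpace.single 1 (1 : ℝ)) = -((1 - lam) * x 1 / 2) * ρ x)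
    (x : EuclideanSpace ℝ (Fin 2)) :
    strainedVorticityOperator lam (fun y => ρ y * u y) x =
      ρ x * (Δ u x - ((1 + lam) / 2 * x 0 * fderiv ℝ u x (EuclideanSpace.single 0 1) +
        (1 - lam) / 2 * x 1 * fderiv ℝ u x (EuclideanSpace.single 1 1))) := by
  have hρu : ContDiff ℝ 2 (fun y => ρ y * u y) := hρ.mul hu
  have hΔρu := laplacian_eq_sum_fderiv_fderiv_apply (EuclideanSpace.basisFun (Fin 2) ℝ) hρu x
  have hΔu := laplacian_eq_sum_fderiv_fderiv_apply (EuclideanSpace.basisFun (Fin 2) ℝ) hu x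
  simp only [Fin.sum_univ_two, EuclideanSpace.basisFun_apply] at hΔρu hΔu
  rw [strainedVorticityOperator, hΔρu, hΔu,
    fderiv_fderiv_weight_mul_apply_single hρ hu 0 hρ0 x,
    fderiv_fderiv_weight_mul_apply_single hρ hu 1 hρ1 x]
  have h0 := congrFun (fderiv_weight_mul_apply_single hρ hu 0 hρ0) x
  have h1 := congrFun (fderiv_weight_mul_apply_single hρ hu 1 hρ1) x
  simp only at h0 h1
  rw [h0, h1]
  ring

end Weight

/-! ### The anisotropic Gaussian `ρ_λ = e^{−q_λ}`: derivative, moments -/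

section GaussLam

variable {lam : ℝ} (hlam : lam ∈ Set.Ico (0 : ℝ) 1)
include hlam

omit hlam in
/-- `Dρ_λ(x)w = −Dq_λ(x)w · ρ_λ(x)` with `q_λ(y) = (1+λ)y₀²/4 + (1−λ)y₁²/4`. [folklore] -/
theorem fderiv_expNegQuadLam_apply (x w : EuclideanSpace ℝ (Fin 2)) :
    fderiv ℝ (fun y : EuclideanSpace ℝ (Fin 2) =>
        Real.exp (-((1 + lam) / 4 * y 0 ^ 2 + (1 - lam) / 4 * y 1 ^ 2))) x w =
      -(fderiv ℝ (fun y : EuclideanSpace ℝ (Fin 2) =>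
          (1 + lam) / 4 * y 0 ^ 2 + (1 - lam) / 4 * y 1 ^ 2) x w *
        Real.exp (-((1 + lam) / 4 * x 0 ^ 2 + (1 - lam) / 4 * x 1 ^ 2))) := by
  rw [(hasFDerivAt_exp_neg_quadraticLam lam x).fderiv, (hasFDerivAt_quadraticLam lam x).fderiv]
  simp only [FunLike.coe_smul, Pi.smul_apply, smul_eq_mul, neg_apply]
  ring

omit hlam in
/-- The drift of `L_λ` is `Dq_λ`: `∑ᵢ ∂ᵢq_λ ∂ᵢu = (1+λ)/2 x₀∂₀u + (1−λ)/2 x₁∂₁u`. [folklore] -/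
theorem sum_fderiv_quadraticLam_mul (u : EuclideanSpace ℝ (Fin 2) → ℝ) (x : EuclideanSpace ℝ (Fin 2)) :
    ∑ i, fderiv ℝ (fun y : EuclideanSpace ℝ (Fin 2) =>
        (1 + lam) / 4 * y 0 ^ 2 + (1 - lam) / 4 * y 1 ^ 2) x (EuclideanSpace.basisFun (Fin 2) ℝ i) *
        fderiv ℝ u x (EuclideanSpace.basisFun (Fin 2) ℝ i) =
      (1 + lam) / 2 * x 0 * fderiv ℝ u x (EuclideanSpace.single 0 1) +
        (1 - lam) / 2 * x 1 * fderiv ℝ u x (EuclideanSpace.single 1 1) := by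
  simp only [Fin.sum_univ_two, EuclideanSpace.basisFun_apply, (hasFDerivAt_quadraticLam lam x).fderiv]
  simp
  ring

/-- `ρ_λ ≤ e^{−(1−λ)|x|²/4} = (4π/(1−λ)) G_λ` for `0 ≤ λ`: the anisotropic Gaussian is dominated
by Gallay–Maekawa's isotropic weight `G_λ` of `L²(∞;λ)` ((4.5)). [cite: GallayMaekawa2016, (4.5)] -/
theorem expNegQuadLam_le_gaussWeightLam (x : EuclideanSpace ℝ (Fin 2)) :
    Real.exp (-((1 + lam) / 4 * x 0 ^ 2 + (1 - lam) / 4 * x 1 ^ 2)) ≤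
      4 * Real.pi / (1 - lam) * gaussWeightLam lam x := by
  obtain ⟨hl0, hl1⟩ := hlam
  have hq : 0 < 1 - lam := by linarith
  rw [gaussWeightLam_eq]
  have hc : 4 * Real.pi / (1 - lam) * ((1 - lam) / (4 * Real.pi) *
      Real.exp (-((1 - lam) / 4 * x 0 ^ 2 + (1 - lam) / 4 * x 1 ^ 2))) =
      Real.exp (-((1 - lam) / 4 * x 0 ^ 2 + (1 - lam) / 4 * x 1 ^ 2)) := by
    field_simp
  rw [hc]
  apply Real.exp_le_exp.2
  nlinarith [sq_nonneg (x 0)]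

/-- `ρ_λ` is integrable. [folklore] -/
theorem integrable_expNegQuadLam :
    Integrable fun y : EuclideanSpace ℝ (Fin 2) =>
      Real.exp (-((1 + lam) / 4 * y 0 ^ 2 + (1 - lam) / 4 * y 1 ^ 2)) := by
  obtain ⟨hl0, hl1⟩ := hlam
  exact integrable_exp_neg_quadratic (a := (1 + lam) / 4) (b := (1 - lam) / 4)
    (by linarith) (by linarith)

/-- **First moment of `ρ_λ`**: `‖x‖ ρ_λ(x)` is integrable (domination by `‖x‖ G_t(x)`,
`t = (1−λ)⁻¹`, `integrable_heatKernel_mul_norm`). [folklore] -/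
theorem integrable_norm_mul_expNegQuadLam :
    Integrable fun x : EuclideanSpace ℝ (Fin 2) =>
      ‖x‖ * Real.exp (-((1 + lam) / 4 * x 0 ^ 2 + (1 - lam) / 4 * x 1 ^ 2)) := by
  obtain ⟨hl0, hl1⟩ := hlam
  have hq : 0 < 1 - lam := by linarith
  set t : ℝ := (1 - lam)⁻¹ with ht
  have htpos : 0 < t := by positivity
  -- `G_t = ((1−λ)/(4π)) e^{−(1−λ)|x|²/4} = G_λ` on `ℝ²`
  have hK : ∀ x : EuclideanSpace ℝ (Fin 2), heatKernel t x = gaussWeightLam lam x := by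
    intro x
    rw [heatKernel, gaussWeightLam, finrank_euclideanSpace_fin]
    have h1 : (4 * π * t) ^ (-((2 : ℕ) : ℝ) / 2) = (1 - lam) / (4 * Real.pi) := by
      rw [show (-((2 : ℕ) : ℝ) / 2) = -1 by norm_num, Real.rpow_neg_one, ht]
      field_simp
    have h2 : -‖x‖ ^ 2 / (4 * t) = -((1 - lam) / 4 * ‖x‖ ^ 2) := by
      rw [ht]; field_simp
    rw [h1, h2]
  have hdom := (integrable_heatKernel_mul_norm (E := EuclideanSpace ℝ (Fin 2)) htpos).const_mul
    (4 * Real.pi / (1 - lam))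
  refine hdom.mono' ((continuous_norm.mul
    (contDiff_exp_neg_quadraticLam lam (n := 0)).continuous).aestronglyMeasurable)
    (Eventually.of_forall fun x => ?_)
  rw [Real.norm_of_nonneg (by positivity), hK]
  calc ‖x‖ * Real.exp (-((1 + lam) / 4 * x 0 ^ 2 + (1 - lam) / 4 * x 1 ^ 2))
      ≤ ‖x‖ * (4 * Real.pi / (1 - lam) * gaussWeightLam lam x) :=
        mul_le_mul_of_nonneg_left (expNegQuadLam_le_gaussWeightLam ⟨hl0, hl1⟩ x) (norm_nonneg _)
    _ = 4 * Real.pi / (1 - lam) * (gaussWeightLam lam x * ‖x‖) := by ring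

/-- **`‖Dρ_λ‖ ∈ L¹`**: `‖Dρ_λ(x)‖ ≤ ‖x‖ ρ_λ(x)` (the drift `b_λ(x) = Dq_λ(x)` has norm at most
`‖x‖` for `0 ≤ λ < 1`). [folklore] -/
theorem integrable_norm_fderiv_expNegQuadLam :
    Integrable fun x : EuclideanSpace ℝ (Fin 2) => ‖fderiv ℝ (fun y : EuclideanSpace ℝ (Fin 2) =>
      Real.exp (-((1 + lam) / 4 * y 0 ^ 2 + (1 - lam) / 4 * y 1 ^ 2))) x‖ := by
  obtain ⟨hl0, hl1⟩ := hlam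
  refine (integrable_norm_mul_expNegQuadLam ⟨hl0, hl1⟩).mono'
    ((contDiff_exp_neg_quadraticLam lam (n := 1)).continuous_fderiv
      one_ne_zero).norm.aestronglyMeasurable (Eventually.of_forall fun x => ?_)
  rw [norm_norm, (hasFDerivAt_exp_neg_quadraticLam lam x).fderiv, norm_smul, norm_neg,
    Real.norm_of_nonneg (Real.exp_pos _).le, mul_comm]
  refine mul_le_mul_of_nonneg_right ?_ (Real.exp_pos _).le
  refine ContinuousLinearMap.opNorm_le_bound _ (norm_nonneg _) fun v => ?_
  have hx0 : |x 0| ≤ ‖x‖ := by simpa [Real.norm_eq_abs] using PiLp.norm_apply_le x 0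
  have hx1 : |x 1| ≤ ‖x‖ := by simpa [Real.norm_eq_abs] using PiLp.norm_apply_le x 1
  have hv0 : |v 0| ≤ ‖v‖ := by simpa [Real.norm_eq_abs] using PiLp.norm_apply_le v 0
  have hv1 : |v 1| ≤ ‖v‖ := by simpa [Real.norm_eq_abs] using PiLp.norm_apply_le v 1
  have hp0 : |x 0 * v 0| ≤ ‖x‖ * ‖v‖ := by
    rw [abs_mul]; exact mul_le_mul hx0 hv0 (abs_nonneg _) (norm_nonneg _)
  have hp1 : |x 1 * v 1| ≤ ‖x‖ * ‖v‖ := by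
    rw [abs_mul]; exact mul_le_mul hx1 hv1 (abs_nonneg _) (norm_nonneg _)
  obtain ⟨hp0l, hp0r⟩ := abs_le.1 hp0
  obtain ⟨hp1l, hp1r⟩ := abs_le.1 hp1
  have hAv : (((1 + lam) / 4 * (2 * x 0)) •
        (EuclideanSpace.proj 0 : EuclideanSpace ℝ (Fin 2) →L[ℝ] ℝ) +
      ((1 - lam) / 4 * (2 * x 1)) •
        (EuclideanSpace.proj 1 : EuclideanSpace ℝ (Fin 2) →L[ℝ] ℝ)) v =
      (1 + lam) / 2 * (x 0 * v 0) + (1 - lam) / 2 * (x 1 * v 1) := by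
    simp only [add_apply, FunLike.coe_smul, Pi.smul_apply, smul_eq_mul]
    simp
    ring
  rw [hAv, Real.norm_eq_abs, abs_le]
  have hc0 : (0 : ℝ) ≤ (1 + lam) / 2 := by linarith
  have hc1 : (0 : ℝ) ≤ (1 - lam) / 2 := by linarith
  constructor
  · nlinarith [mul_le_mul_of_nonneg_left hp0l hc0, mul_le_mul_of_nonneg_left hp1l hc1]
  · nlinarith [mul_le_mul_of_nonneg_left hp0r hc0, mul_le_mul_of_nonneg_left hp1r hc1]

/-! ### Dirichlet form and spectral gap of `L_λ` in `L²(ρ_λ⁻¹ dx)` -/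

/-- **The Dirichlet form of `L_λ` in `L²(ρ_λ⁻¹dx)`** (equivalently of the Ornstein–Uhlenbeck
operator `ρ_λ⁻¹L_λρ_λ = Δ − b_λ·∇` in `L²(ρ_λ dx)`): for `u ∈ C²` with `Du, D²u` bounded and
`v ∈ C¹` with `v, Dv` bounded,
`∫ (Δu − ((1+λ)/2 x₀∂₀u + (1−λ)/2 x₁∂₁u)) v ρ_λ = −∫ (∂₀u ∂₀v + ∂₁u ∂₁v) ρ_λ`.
Symmetric in `u, v` and `≤ 0` on the diagonal: `L_λ` is symmetric and dissipative on
`L²(ρ_λ⁻¹dx) ⊂ L²(∞;λ)` for every `λ ∈ [0,1)`. [folklore] -/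
theorem integral_adjointLam_mul_mul_expNegQuadLam {u v : EuclideanSpace ℝ (Fin 2) → ℝ}
    (hu : ContDiff ℝ 2 u) (hv : ContDiff ℝ 1 v) {C₁ C₂ D₀ D₁ : ℝ}
    (hu1 : ∀ x, ‖fderiv ℝ u x‖ ≤ C₁) (hu2 : ∀ x, ‖fderiv ℝ (fderiv ℝ u) x‖ ≤ C₂)
    (hv0 : ∀ x, ‖v x‖ ≤ D₀) (hv1 : ∀ x, ‖fderiv ℝ v x‖ ≤ D₁) :
    ∫ x : EuclideanSpace ℝ (Fin 2),
        (Δ u x - ((1 + lam) / 2 * x 0 * fderiv ℝ u x (EuclideanSpace.single 0 1) +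
          (1 - lam) / 2 * x 1 * fderiv ℝ u x (EuclideanSpace.single 1 1))) * v x *
          Real.exp (-((1 + lam) / 4 * x 0 ^ 2 + (1 - lam) / 4 * x 1 ^ 2)) =
      -∫ x : EuclideanSpace ℝ (Fin 2),
        (fderiv ℝ u x (EuclideanSpace.single 0 1) * fderiv ℝ v x (EuclideanSpace.single 0 1) +
          fderiv ℝ u x (EuclideanSpace.single 1 1) * fderiv ℝ v x (EuclideanSpace.single 1 1)) *
          Real.exp (-((1 + lam) / 4 * x 0 ^ 2 + (1 - lam) / 4 * x 1 ^ 2)) := by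
  have key := integral_ornsteinUhlenbeck_mul_mul_weight
    (ρ := fun y : EuclideanSpace ℝ (Fin 2) =>
      Real.exp (-((1 + lam) / 4 * y 0 ^ 2 + (1 - lam) / 4 * y 1 ^ 2)))
    (V := fun y : EuclideanSpace ℝ (Fin 2) => (1 + lam) / 4 * y 0 ^ 2 + (1 - lam) / 4 * y 1 ^ 2)
    (contDiff_exp_neg_quadraticLam lam (n := 1)) (integrable_expNegQuadLam hlam)
    (integrable_norm_fderiv_expNegQuadLam hlam) fderiv_expNegQuadLam_apply
    hu hv hu1 hu2 hv0 hv1 (EuclideanSpace.basisFun (Fin 2) ℝ)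
  simp only [sum_fderiv_quadraticLam_mul] at key
  simp only [Fin.sum_univ_two, EuclideanSpace.basisFun_apply] at key
  exact key

/-- **Spectral gap `(1−λ)/2` of `L_λ` in `L²(ρ_λ⁻¹dx)` on mean-zero vorticities, for every
`λ ∈ [0,1)`** (quadratic-form version; `λ = 0`: Gallay–Wayne 2005, Prop. 4.1 / App. A, gap `½`):
for `w = ρ_λ u` with `u ∈ C²(ℝ²)`, `u, Du, D²u` bounded and `∫ w = 0`,
`⟨L_λ w, w⟩ = ∫ (L_λ w) w / ρ_λ ≤ −(1−λ)/2 · ∫ w²/ρ_λ = −(1−λ)/2 · ‖w‖²`,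
`L_λ = strainedVorticityOperator lam` (Gallay–Maekawa 2016, (4.3)), from the ground-state
conjugation, the Dirichlet form and the anisotropic Gaussian Poincaré inequality
(`integral_sq_mul_expNegQuadLam_le`). [cite: GallayMaekawa2016, (4.3)–(4.4)] -/
theorem integral_strainedVorticityOperator_mul_div_expNegQuadLam_le
    {u : EuclideanSpace ℝ (Fin 2) → ℝ} (hu : ContDiff ℝ 2 u) {C₀ C₁ C₂ : ℝ}
    (h0 : ∀ x, ‖u x‖ ≤ C₀) (h1 : ∀ x, ‖fderiv ℝ u x‖ ≤ C₁)
    (h2 : ∀ x, ‖fderiv ℝ (fderiv ℝ u) x‖ ≤ C₂)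
    (hmean : ∫ x : EuclideanSpace ℝ (Fin 2),
      Real.exp (-((1 + lam) / 4 * x 0 ^ 2 + (1 - lam) / 4 * x 1 ^ 2)) * u x = 0) :
    ∫ x : EuclideanSpace ℝ (Fin 2),
        strainedVorticityOperator lam (fun y =>
            Real.exp (-((1 + lam) / 4 * y 0 ^ 2 + (1 - lam) / 4 * y 1 ^ 2)) * u y) x *
          (Real.exp (-((1 + lam) / 4 * x 0 ^ 2 + (1 - lam) / 4 * x 1 ^ 2)) * u x) /
          Real.exp (-((1 + lam) / 4 * x 0 ^ 2 + (1 - lam) / 4 * x 1 ^ 2)) ≤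
      -((1 - lam) / 2) * ∫ x : EuclideanSpace ℝ (Fin 2),
        (Real.exp (-((1 + lam) / 4 * x 0 ^ 2 + (1 - lam) / 4 * x 1 ^ 2)) * u x) ^ 2 /
          Real.exp (-((1 + lam) / 4 * x 0 ^ 2 + (1 - lam) / 4 * x 1 ^ 2)) := by
  set ρ : EuclideanSpace ℝ (Fin 2) → ℝ := fun y =>
    Real.exp (-((1 + lam) / 4 * y 0 ^ 2 + (1 - lam) / 4 * y 1 ^ 2)) with hρ_def
  have hρpos : ∀ y, 0 < ρ y := fun y => Real.exp_pos _
  have hρ2 : ContDiff ℝ 2 ρ := contDiff_exp_neg_quadraticLam lam (n := 2)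
  have hρ0 := fderiv_exp_neg_quadraticLam_zero lam
  have hρ1 := fderiv_exp_neg_quadraticLam_one lam
  -- pointwise: the conjugated operator, and `w²/ρ = u²ρ`
  have e1 : (fun x => strainedVorticityOperator lam (fun y => ρ y * u y) x * (ρ x * u x) / ρ x) =
      fun x => (Δ u x - ((1 + lam) / 2 * x 0 * fderiv ℝ u x (EuclideanSpace.single 0 1) +
        (1 - lam) / 2 * x 1 * fderiv ℝ u x (EuclideanSpace.single 1 1))) * u x * ρ x := by
    funext x
    rw [strainedVorticityOperator_weight_mul hρ2 hu lam hρ0 hρ1 x]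
    have := (hρpos x).ne'
    field_simp
  have e2 : (fun x => (ρ x * u x) ^ 2 / ρ x) = fun x => u x ^ 2 * ρ x := by
    funext x
    have := (hρpos x).ne'
    field_simp
  rw [e1, e2, integral_adjointLam_mul_mul_expNegQuadLam hlam hu (hu.of_le one_le_two) h1 h2 h0 h1]
  -- Poincaré
  have hmean' : ∫ x, u x * ρ x = 0 := by
    rw [← hmean]; exact integral_congr_ae (Eventually.of_forall fun x => mul_comm _ _)
  have hP := integral_sq_mul_expNegQuadLam_le hlam (hu.of_le one_le_two) h0 h1 hmean'
  have hsum : ∀ x, fderiv ℝ u x (EuclideanSpace.single 0 1) * fderiv ℝ u x (EuclideanSpace.single 0 1) +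
      fderiv ℝ u x (EuclideanSpace.single 1 1) * fderiv ℝ u x (EuclideanSpace.single 1 1) =
      ‖fderiv ℝ u x‖ ^ 2 := fun x => by
    rw [← sum_sq_apply_orthonormalBasis (EuclideanSpace.basisFun (Fin 2) ℝ)]
    simp [Fin.sum_univ_two, sq]
  simp_rw [hsum]
  linarith

/-- **`L²(ρ_λ⁻¹dx) ⊆ L²(∞;λ)`**: if `w²/ρ_λ` is integrable then `w ∈ L²(∞;λ)`, the space of
Gallay–Maekawa 2016, (4.6), since `ρ_λ ≤ (4π/(1−λ)) G_λ`. Thus any asymmetric Burgers vortex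
constructed in the self-adjoint space `L²(ρ_λ⁻¹dx)` of `L_λ` satisfies the membership clause of
Theorem 4.1. [cite: GallayMaekawa2016, (4.6)] -/
theorem memL2InftyLam_of_integrable_sq_div_expNegQuadLam {w : EuclideanSpace ℝ (Fin 2) → ℝ}
    (hw : AEStronglyMeasurable w volume)
    (hwi : Integrable fun x : EuclideanSpace ℝ (Fin 2) =>
      w x ^ 2 / Real.exp (-((1 + lam) / 4 * x 0 ^ 2 + (1 - lam) / 4 * x 1 ^ 2))) :
    MemL2InftyLam lam w := by
  obtain ⟨hl0, hl1⟩ := hlam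
  have hq : 0 < 1 - lam := by linarith
  refine ⟨hw, ?_⟩
  have hGc : Continuous (gaussWeightLam lam) := by
    unfold gaussWeightLam
    exact continuous_const.mul (Real.continuous_exp.comp
      (continuous_const.mul (continuous_norm.pow 2)).neg)
  have hmeas : AEStronglyMeasurable (fun x => w x ^ 2 / gaussWeightLam lam x) volume := by
    have : (fun x => w x ^ 2 / gaussWeightLam lam x) =
        fun x => w x ^ 2 * (gaussWeightLam lam x)⁻¹ := by
      funext x; rw [div_eq_mul_inv]
    rw [this]
    exact (hw.pow 2).mul
      (hGc.inv₀ fun x => (gaussWeightLam_pos hl1 x).ne').aestronglyMeasurable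
  refine (hwi.const_mul (4 * Real.pi / (1 - lam))).mono' hmeas
    (Eventually.of_forall fun x => ?_)
  have hG := gaussWeightLam_pos hl1 x
  have hρ := Real.exp_pos (-((1 + lam) / 4 * x 0 ^ 2 + (1 - lam) / 4 * x 1 ^ 2))
  have hle := expNegQuadLam_le_gaussWeightLam ⟨hl0, hl1⟩ x
  rw [Real.norm_of_nonneg (by positivity), div_le_iff₀ hG]
  calc w x ^ 2 = w x ^ 2 / Real.exp (-((1 + lam) / 4 * x 0 ^ 2 + (1 - lam) / 4 * x 1 ^ 2)) *
        Real.exp (-((1 + lam) / 4 * x 0 ^ 2 + (1 - lam) / 4 * x 1 ^ 2)) := by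
        field_simp
    _ ≤ w x ^ 2 / Real.exp (-((1 + lam) / 4 * x 0 ^ 2 + (1 - lam) / 4 * x 1 ^ 2)) *
        (4 * Real.pi / (1 - lam) * gaussWeightLam lam x) :=
        mul_le_mul_of_nonneg_left hle (by positivity)
    _ = 4 * Real.pi / (1 - lam) *
        (w x ^ 2 / Real.exp (-((1 + lam) / 4 * x 0 ^ 2 + (1 - lam) / 4 * x 1 ^ 2))) *
        gaussWeightLam lam x := by ring

/-- **Vorticities `w = ρ_λ u` with bounded `u` lie in `L²(ρ_λ⁻¹dx)`** (hence in `L²(∞;λ)`):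
`w²/ρ_λ = u² ρ_λ` is integrable. In particular `𝒢_λ` and all the profiles `𝒢_λ u` of the
spectral-gap estimate belong to the space of Theorem 4.1. [folklore] -/
theorem integrable_sq_expNegQuadLam_mul_div {u : EuclideanSpace ℝ (Fin 2) → ℝ}
    (hu : Continuous u) {C₀ : ℝ} (h0 : ∀ x, ‖u x‖ ≤ C₀) :
    Integrable fun x : EuclideanSpace ℝ (Fin 2) =>
      (Real.exp (-((1 + lam) / 4 * x 0 ^ 2 + (1 - lam) / 4 * x 1 ^ 2)) * u x) ^ 2 /
        Real.exp (-((1 + lam) / 4 * x 0 ^ 2 + (1 - lam) / 4 * x 1 ^ 2)) := by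
  have hC₀ : 0 ≤ C₀ := (norm_nonneg _).trans (h0 0)
  have e : (fun x : EuclideanSpace ℝ (Fin 2) =>
      (Real.exp (-((1 + lam) / 4 * x 0 ^ 2 + (1 - lam) / 4 * x 1 ^ 2)) * u x) ^ 2 /
        Real.exp (-((1 + lam) / 4 * x 0 ^ 2 + (1 - lam) / 4 * x 1 ^ 2))) =
      fun x => u x ^ 2 * Real.exp (-((1 + lam) / 4 * x 0 ^ 2 + (1 - lam) / 4 * x 1 ^ 2)) := by
    funext x
    have := (Real.exp_pos (-((1 + lam) / 4 * x 0 ^ 2 + (1 - lam) / 4 * x 1 ^ 2))).ne'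
    field_simp
  rw [e]
  exact (integrable_expNegQuadLam hlam).bdd_mul (hu.pow 2).aestronglyMeasurable
    (Eventually.of_forall fun x => by
      rw [norm_pow]; exact pow_le_pow_left₀ (norm_nonneg _) (h0 x) 2)

end GaussLam

end Literature.Analysis.FluidPDE
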